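import Summits.AtomisticToContinuum.Crystallization.Theses.MinMeanCycleStackingLock

/-!
# Route `MinMeanCycleStackingLock`, item stmt-AtomisticToContinuum-12021 `CertificateLocks`

The glue of the target of route `AtomisticToContinuum/Crystallization/MinMeanCycleStackingLock`:

`PeierlsKarpStability → LJLockingCertificate → LockedStackingOnBox`.

Pure instantiation: at each `(a, h)` in the relaxation box the certificate `LJLockingCertificate`
hands out the window length `L + 1`, the cycle set `E`, node potentials `u`, a value `λ` and a gap
`g` with the summability, slack and tail clauses; the stability lemma `PeierlsKarpStability`
applied to these data gives a periodic sequence `w` all of whose `(L+1)`-windows lie in `E` and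
which minimises `haggStackingEnergy J` over all Hägg sequences.  Since every word of `E` is a
`±1`-word (first clause of the certificate), the window of `w` at `i` evaluated at index `0` shows
`w i = ±1`, i.e. `w` is itself a Hägg sequence.
-/

namespace Summit.AtomisticToContinuum.Crystallization.Theorems

open Summit.AtomisticToContinuum.Crystallization.Theses.MinMeanCycleStackingLock

/-- **Item stmt-AtomisticToContinuum-12021** (`CertificateLocks`, route `MinMeanCycleStackingLock`):
`PeierlsKarpStability → LJLockingCertificate → LockedStackingOnBox`.  Destructure the certificate,
specialise it at `(a, h)`, feed the data to the stability lemma, and read off `IsHaggSeq w` from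
the `±1` clause on the window of `w` at `i` (index `0`). -/
theorem certificateLocks_proof :
    Summit.AtomisticToContinuum.Crystallization.Theses.MinMeanCycleStackingLock.CertificateLocks := by
  unfold Summit.AtomisticToContinuum.Crystallization.Theses.MinMeanCycleStackingLock.CertificateLocks
  intro hstab hcert
  unfold LockedStackingOnBox
  intro a h ha1 ha2 hh1 hh2
  obtain ⟨L, E, hne, hout, hin, hcont, hbox⟩ := hcert
  obtain ⟨hsum, u, lam, g, hzero, hgap, htail⟩ := hbox a h ha1 ha2 hh1 hh2
  refine ⟨hsum, ?_⟩
  obtain ⟨w, p, hp, hper, hwin, hleast⟩ :=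
    hstab _ L E u lam g hsum hne hout hin hcont hzero hgap htail
  refine ⟨w, p, hp, hper, ?_, hleast⟩
  intro i
  have h0 := (hzero _ (hwin i)).1 0
  simpa using h0

end Summit.AtomisticToContinuum.Crystallization.Theorems
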